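import Mathlib
import HarnessLib
import Summits.HubbardSuperconductivity.HubbardSuperconductivity.Theorems.KLProgrammeH10TwoPointLimitStripTarget
import Summits.HubbardSuperconductivity.HubbardSuperconductivity.Theorems.KLProgrammeH10RungBetaUCorner

/-!
# Route `KLProgramme` — crux K1 `H10TwoPointLimit` (stmt-HubbardSuperconductivity-19938): the strip target in the coordinates of the tree's
# own complex-coupling engine — the finite-`M` Grassmann ratio `hubbardRatio` bounded, and its denominator zero-free, on the strip

Seat leafhand-hubbard-klprogramme-4 (visitor hand on K1, 2026-08-31), continuation of `…Theorems.KLProgrammeH10TwoPointLimitStripTarget`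
(`H10TwoPointLimit_of_matsubaraStrip`).  The rung-R0 core `…H10RungBetaUCorner.R0_core_at` obtains its disc `|u| < κ_U/β` of `L`-uniform
analyticity from exactly two engine facts about the finite-`M` Grassmann two-point ratio at complex coupling
(`Literature…HubbardComplexCouplingRatio.hubbardRatio`, fixed covariance `C_μ`, complex action `uV₁ + (u/2)N̂`):
`hubbardRatioDen L M β μ u ≠ 0` and `‖hubbardRatio L M β μ x y σ σ' u‖ ≤ Mb` on the disc, uniformly in `L ≥ L₀(β)`, `M ≥ M₀(β, L)`
(`HubbardBetaUBound.norm_hubbardRatio_le_betaUMb`); the Matsubara bridge at small REAL couplings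
(`tendsto_grassmannTwoPoint_eq_hubbardThermalTwoPoint_sub`, `hubbardRatio_ofReal`, `bridge_small`) and Montel do the rest.

**`H10TwoPointLimit_of_hubbardRatio_strip`**: the SAME two facts on the strip `S(β) = {|Re u| < a₀/log β, |Im u| < κ/β}` for `β ≥ β₀`, `β > 1`
— and nothing else — give K1.  This is the one open stub of the Vitali line in the engine's own currency: extend
`norm_hubbardRatio_le_betaUMb` from the disc `|u| ≤ κ_U/β` to the strip (BGM 2006 Thm 2.1-type sectorised bounds; XL; the width `κ/β` keeps
the complex Hartree shift inside `|β·Im(u/2 + uT)| ≤ π/4`, the standing hypothesis of `hubbardRatio_eq_grid`).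

Everything here is PROVED (composition); no definition, no named fact; nothing about the Hubbard model is asserted beyond the CLOSED
theorems cited.  References: BGM 2006 [cite: BenfattoGiulianiMastropietro2006, Thm 2.1, §2.3 (2.21)–(2.24)].
-/

noncomputable section

namespace Summit.HubbardSuperconductivity.HubbardSuperconductivity.Theorems.H10VitaliLine

set_option linter.dupNamespace false -- summit = problem name (single-conjunct summit), D-0017

open Filter Set Metric Topology Complex
open Literature.MathematicalPhysics.QuantumLattice Literature.Probability.LatticeModels

/-- **Crux K1 `H10TwoPointLimit` from the finite-`M` Grassmann ratio on the strip**: if there are `a₀, κ > 0` and `β₀` such that for every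
`β ≥ β₀` with `β > 1`, every `μ ∈ [-1, -0.15]` and all sites/spins there are a bound `Bd` and a threshold `L₀` with, for every `L ≥ L₀`,
`L ≠ 0`, some `M₀` such that for all `M ≥ M₀` and all `u` with `|Re u| < a₀/log β`, `|Im u| < κ/β`:
`hubbardRatioDen L M β μ u ≠ 0` and `‖hubbardRatio L M β μ x̄ ȳ σ σ' u‖ ≤ Bd` (`x̄ = Torus.proj L x`) — then K1 holds.
[cite: BenfattoGiulianiMastropietro2006, Thm 2.1] -/
theorem H10TwoPointLimit_of_hubbardRatio_strip {a₀ κ β₀ : ℝ} (ha₀ : 0 < a₀) (hκ : 0 < κ)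
    (h : ∀ β : ℝ, β₀ ≤ β → 1 < β → ∀ μ ∈ Set.Icc (-1 : ℝ) (-0.15), ∀ (x y : Site 2) (σ σ' : Fin 2),
      ∃ (Bd : ℝ) (L₀ : ℕ), ∀ (L : ℕ) [NeZero L], L₀ ≤ L → ∃ M₀ : ℕ, ∀ M : ℕ, M₀ ≤ M →
        ∀ u ∈ {z : ℂ | |z.re| < a₀ / Real.log β ∧ |z.im| < κ / β},
          hubbardRatioDen L M β μ u ≠ 0 ∧ ‖hubbardRatio L M β μ (Torus.proj L x) (Torus.proj L y) σ σ' u‖ ≤ Bd) :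
    Summit.HubbardSuperconductivity.HubbardSuperconductivity.Theses.KLProgramme.H10TwoPointLimit := by
  refine H10TwoPointLimit_of_matsubaraStrip (β₀ := β₀) ha₀ hκ fun β hβ₀ hβ1 μ hμ x y σ σ' => ?_
  have hβ0 : 0 < β := zero_lt_one.trans hβ1
  obtain ⟨Bd, L₀, hL⟩ := h β hβ₀ hβ1 μ hμ x y σ σ'
  refine ⟨Bd, 1 / 2, max L₀ 3, fun L hLL => ?_⟩
  have hL3 : 3 ≤ L := (le_max_right _ _).trans hLL
  haveI : NeZero L := ⟨by omega⟩
  obtain ⟨M₀, hM⟩ := hL L ((le_max_left _ _).trans hLL)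
  have hμabs : |μ| ≤ 1 := by
    rw [abs_le]
    exact ⟨hμ.1, hμ.2.trans (by norm_num)⟩
  -- the bridge radius of `R0_core_at`
  set ρ : ℝ := min 1 (1 / (3 * Real.exp 1 * ((L : ℝ) ^ 2 * β) * (2 + 2 * β) ^ 2 + 1)) with hρ_def
  have hρ0 : 0 < ρ := lt_min one_pos (by positivity)
  -- the Grassmann ratio's `½` on the diagonal
  set corr : ℂ := if σ = σ' ∧ Torus.proj L x = Torus.proj L y then (1 / 2 : ℂ) else 0 with hcorr
  have hc : ‖corr‖ ≤ 1 / 2 := by rw [hcorr]; split_ifs <;> simp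
  refine ⟨M₀, corr, ρ, fun M => hubbardRatio L M β μ (Torus.proj L x) (Torus.proj L y) σ σ', hc, hρ0, ?_, ?_, ?_⟩
  · intro M hMM
    exact differentiableOn_hubbardRatio β μ _ _ σ σ' fun u hu => (hM M hMM u hu).1
  · intro M hMM z hz
    exact (hM M hMM z hz).2
  · intro t ht0 ht _
    have ht1 : |t| ≤ 1 := ht.le.trans (min_le_left _ _)
    have htb : |t| < 1 / (3 * Real.exp 1 * ((L : ℝ) ^ 2 * β) * (2 + 2 * β) ^ 2 + 1) :=
      lt_of_lt_of_le ht (min_le_right _ _)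
    have hsm := bridge_small (L := L) hβ0 hμabs ht1 htb
    have hbr := tendsto_grassmannTwoPoint_eq_hubbardThermalTwoPoint_sub hL3 hβ0 (μ - t / 2) σ σ' x y hsm
    rw [sub_add_cancel] at hbr
    refine hbr.congr fun M => ?_
    exact (hubbardRatio_ofReal hβ0 μ _ _ σ σ' t).symm

/-! ## §2 (appended) The rung-R2d LEAF `H1TwoPointLimitKLScaleD` from the same two engine facts on the WIDER strip
`|Re u| < √(c₀ / log β)` (the Kohn–Luttinger depth `β ≤ e^{c/U²}`, `c := c₀/4`) -/

/-- **The leaf's regime sits inside the half-width `√(c₀/log β)`**: with `c := c₀/4`, for `β > 1` every admissible coupling `0 < U`,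
`β ≤ e^{c/U²}` satisfies `U < √(c₀ / log β)` (i.e. `U²·log β ≤ c₀/4 < c₀`). [folklore] -/
theorem lt_sqrt_div_log_of_le_exp_quarter {c₀ U β : ℝ} (hc₀ : 0 < c₀) (hU : 0 < U) (hβ : 1 < β)
    (hβU : β ≤ Real.exp (c₀ / 4 / U ^ 2)) : U < Real.sqrt (c₀ / Real.log β) := by
  have hlog : 0 < Real.log β := Real.log_pos hβ
  have hU2 : 0 < U ^ 2 := by positivity
  have h1 : Real.log β ≤ c₀ / 4 / U ^ 2 := (Real.log_le_iff_le_exp (zero_lt_one.trans hβ)).2 hβU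
  have h2 : U ^ 2 * Real.log β ≤ U ^ 2 * (c₀ / 4 / U ^ 2) := mul_le_mul_of_nonneg_left h1 hU2.le
  have h3 : U ^ 2 * (c₀ / 4 / U ^ 2) = c₀ / 4 := by field_simp
  have h4 : U ^ 2 < c₀ / Real.log β := by rw [lt_div_iff₀ hlog]; linarith
  exact (Real.lt_sqrt hU.le).2 h4

/-- **The rung-R2d leaf `H1TwoPointLimitKLScaleD` from the STRIP** (`L`-uniformly bounded holomorphic extensions on
`{|Re u| < √(c₀/log β), |Im u| < κ/β}`, `β ≥ β₀`, `β > 1` only; closed compact box below `max β₀ 2`; `c := c₀/4`).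
[cite: BenfattoGiulianiMastropietro2006, Thm 1.1 / Thm 2.1] -/
theorem leaf_of_strip {c₀ κ β₀ : ℝ} (hc₀ : 0 < c₀) (hκ : 0 < κ)
    (h : ∀ β : ℝ, β₀ ≤ β → 1 < β → ∀ μ ∈ Set.Icc (-1 : ℝ) (-0.15), ∀ (x y : Site 2) (σ σ' : Fin 2),
      ∃ (L₀ : ℕ) (M : ℝ) (G : ℕ → ℂ → ℂ),
        (∀ L, L₀ ≤ L → DifferentiableOn ℂ (G L) {z : ℂ | |z.re| < Real.sqrt (c₀ / Real.log β) ∧ |z.im| < κ / β}) ∧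
        (∀ L, L₀ ≤ L → ∀ z ∈ {z : ℂ | |z.re| < Real.sqrt (c₀ / Real.log β) ∧ |z.im| < κ / β}, ‖G L z‖ ≤ M) ∧
        (∀ L, L₀ ≤ L → ∃ ρ : ℝ, 0 < ρ ∧ ∀ t : ℝ, 0 < |t| → |t| < ρ →
          G L (t : ℂ) = hubbardThermalTwoPoint β t μ L x y σ σ')) :
    Summit.HubbardSuperconductivity.HubbardSuperconductivity.Theses.WeakCouplingBCS.H1TwoPointLimitKLScaleD := by
  set B : ℝ := max β₀ 2 with hB_def
  obtain ⟨r, hr, hbox⟩ := h10rung_twoPoint_limit_box B (-1) (-0.15)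
  refine ⟨r / 2, c₀ / 4, half_pos hr, by positivity, fun δ hδ U β hU hUle hβ hβc x y σ σ' => ?_⟩
  have hμ := Summit.HubbardSuperconductivity.HubbardSuperconductivity.Theses.KLProgramme.MuOfDopingWindow_holds δ hδ
  by_cases hβB : β ≤ B
  · have hUr : |U| < r := by rw [abs_of_pos hU]; linarith
    exact hbox β ⟨hβ, hβB⟩ _ hμ U hUr x y σ σ'
  · have hβB' : B < β := lt_of_not_ge hβB
    have hβ₀ : β₀ ≤ β := (le_max_left _ _).trans hβB'.le
    have hβ1 : 1 < β := by have h2 : (2 : ℝ) ≤ B := le_max_right β₀ 2; linarith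
    obtain ⟨L₀, M, G, hd, hM, hagree⟩ := h β hβ₀ hβ1 _ hμ x y σ σ'
    have hUr : U < Real.sqrt (c₀ / Real.log β) := lt_sqrt_div_log_of_le_exp_quarter hc₀ hU hβ1 hβc
    exact tendsto_hubbardThermalTwoPoint_of_connected_extension_nearZero hβ _ x y σ σ'
      (isOpen_reImStrip _ _) (convex_reImStrip _ _).isPreconnected
      (zero_mem_reImStrip (Real.sqrt_pos.2 (div_pos hc₀ (Real.log_pos hβ1))) (div_pos hκ hβ)) hd
      (fun _ _ => ⟨M, 1, one_pos, fun L hL z hz => hM L hL z hz.2⟩) hagree hU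
      (fun t ht => ofReal_mem_reImStrip (div_pos hκ hβ) hUr ht)

/-- **The rung-R2d leaf `H1TwoPointLimitKLScaleD` from the finite-`M` Grassmann ratio on the wider strip**: if there are `c₀, κ > 0` and
`β₀` such that for every `β ≥ β₀` with `β > 1`, every `μ ∈ [-1, -0.15]` and all sites/spins there are `Bd, L₀` with, for every `L ≥ L₀`,
`L ≠ 0`, some `M₀` such that for all `M ≥ M₀` and all `u` with `|Re u| < √(c₀/log β)`, `|Im u| < κ/β`:
`hubbardRatioDen L M β μ u ≠ 0` and `‖hubbardRatio L M β μ x̄ ȳ σ σ' u‖ ≤ Bd` — then the leaf holds (K1 ∧ K3 depth, `β ≤ e^{c/U²}`).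
[cite: BenfattoGiulianiMastropietro2006, Thm 2.1] -/
theorem leaf_of_hubbardRatio_strip {c₀ κ β₀ : ℝ} (hc₀ : 0 < c₀) (hκ : 0 < κ)
    (h : ∀ β : ℝ, β₀ ≤ β → 1 < β → ∀ μ ∈ Set.Icc (-1 : ℝ) (-0.15), ∀ (x y : Site 2) (σ σ' : Fin 2),
      ∃ (Bd : ℝ) (L₀ : ℕ), ∀ (L : ℕ) [NeZero L], L₀ ≤ L → ∃ M₀ : ℕ, ∀ M : ℕ, M₀ ≤ M →
        ∀ u ∈ {z : ℂ | |z.re| < Real.sqrt (c₀ / Real.log β) ∧ |z.im| < κ / β},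
          hubbardRatioDen L M β μ u ≠ 0 ∧ ‖hubbardRatio L M β μ (Torus.proj L x) (Torus.proj L y) σ σ' u‖ ≤ Bd) :
    Summit.HubbardSuperconductivity.HubbardSuperconductivity.Theses.WeakCouplingBCS.H1TwoPointLimitKLScaleD := by
  refine leaf_of_strip (β₀ := β₀) hc₀ hκ fun β hβ₀ hβ1 μ hμ x y σ σ' => ?_
  have hβ0 : 0 < β := zero_lt_one.trans hβ1
  obtain ⟨Bd, L₀, hL⟩ := h β hβ₀ hβ1 μ hμ x y σ σ'
  have h0 : (0 : ℂ) ∈ {z : ℂ | |z.re| < Real.sqrt (c₀ / Real.log β) ∧ |z.im| < κ / β} :=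
    zero_mem_reImStrip (Real.sqrt_pos.2 (div_pos hc₀ (Real.log_pos hβ1))) (div_pos hκ hβ0)
  -- for each large `L`: the bounded Matsubara family `M ↦ hubbardRatio L M`, its bridge at small real couplings, and Montel
  have hG : ∀ L, max L₀ 3 ≤ L → ∃ G : ℂ → ℂ,
      DifferentiableOn ℂ G {z : ℂ | |z.re| < Real.sqrt (c₀ / Real.log β) ∧ |z.im| < κ / β} ∧
      (∀ z ∈ {z : ℂ | |z.re| < Real.sqrt (c₀ / Real.log β) ∧ |z.im| < κ / β}, ‖G z‖ ≤ Bd + 1 / 2) ∧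
      ∃ ρ' : ℝ, 0 < ρ' ∧ ∀ t : ℝ, 0 < |t| → |t| < ρ' → G (t : ℂ) = hubbardThermalTwoPoint β t μ L x y σ σ' := by
    intro L hLL
    have hL3 : 3 ≤ L := (le_max_right _ _).trans hLL
    haveI : NeZero L := ⟨by omega⟩
    obtain ⟨M₀, hM⟩ := hL L ((le_max_left _ _).trans hLL)
    have hμabs : |μ| ≤ 1 := by
      rw [abs_le]
      exact ⟨hμ.1, hμ.2.trans (by norm_num)⟩
    set ρ : ℝ := min 1 (1 / (3 * Real.exp 1 * ((L : ℝ) ^ 2 * β) * (2 + 2 * β) ^ 2 + 1)) with hρ_def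
    have hρ0 : 0 < ρ := lt_min one_pos (by positivity)
    set corr : ℂ := if σ = σ' ∧ Torus.proj L x = Torus.proj L y then (1 / 2 : ℂ) else 0 with hcorr
    have hc : ‖corr‖ ≤ 1 / 2 := by rw [hcorr]; split_ifs <;> simp
    have hg : ∀ M, M₀ ≤ M → DifferentiableOn ℂ (hubbardRatio L M β μ (Torus.proj L x) (Torus.proj L y) σ σ')
        {z : ℂ | |z.re| < Real.sqrt (c₀ / Real.log β) ∧ |z.im| < κ / β} :=
      fun M hMM => differentiableOn_hubbardRatio β μ _ _ σ σ' fun u hu => (hM M hMM u hu).1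
    have hgB : ∀ M, M₀ ≤ M → ∀ z ∈ {z : ℂ | |z.re| < Real.sqrt (c₀ / Real.log β) ∧ |z.im| < κ / β},
        ‖hubbardRatio L M β μ (Torus.proj L x) (Torus.proj L y) σ σ' z‖ ≤ Bd := fun M hMM z hz => (hM M hMM z hz).2
    have hlim : ∀ t : ℝ, 0 < |t| → |t| < ρ → ((t : ℝ) : ℂ) ∈ {z : ℂ | |z.re| < Real.sqrt (c₀ / Real.log β) ∧ |z.im| < κ / β} →
        Tendsto (fun M : ℕ => hubbardRatio L M β μ (Torus.proj L x) (Torus.proj L y) σ σ' (t : ℂ)) atTop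
          (𝓝 (hubbardThermalTwoPoint β t μ L x y σ σ' - corr)) := by
      intro t ht0 ht _
      have ht1 : |t| ≤ 1 := ht.le.trans (min_le_left _ _)
      have htb : |t| < 1 / (3 * Real.exp 1 * ((L : ℝ) ^ 2 * β) * (2 + 2 * β) ^ 2 + 1) :=
        lt_of_lt_of_le ht (min_le_right _ _)
      have hsm := bridge_small (L := L) hβ0 hμabs ht1 htb
      have hbr := tendsto_grassmannTwoPoint_eq_hubbardThermalTwoPoint_sub hL3 hβ0 (μ - t / 2) σ σ' x y hsm
      rw [sub_add_cancel] at hbr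
      refine hbr.congr fun M => ?_
      exact (hubbardRatio_ofReal hβ0 μ _ _ σ σ' t).symm
    obtain ⟨G, hGd, hGB, ρ', hρ', hagree⟩ := extension_of_matsubara_family (isOpen_reImStrip _ _) h0 hρ0 hg hgB hlim
    exact ⟨G, hGd, fun z hz => (hGB z hz).trans (by linarith), ρ', hρ', hagree⟩
  choose G hGd hGB ρ' hρ' hagree using hG
  refine ⟨max L₀ 3, Bd + 1 / 2, fun L => if hL' : max L₀ 3 ≤ L then G L hL' else 0, ?_, ?_, ?_⟩
  · intro L hLL; simp only [hLL, ↓reduceDIte]; exact hGd L hLL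
  · intro L hLL z hz; simp only [hLL, ↓reduceDIte]; exact hGB L hLL z hz
  · intro L hLL; simp only [hLL, ↓reduceDIte]; exact ⟨ρ' L hLL, hρ' L hLL, hagree L hLL⟩

end Summit.HubbardSuperconductivity.HubbardSuperconductivity.Theorems.H10VitaliLine

end
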